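import Summits.QuantumFields.YangMills.Theorems.UnitScaleTiltProp7FibreRemainderL1Level
import HarnessLib

/-!
# Line «poincare_lipschitz» on crux `HistoryTailL` (stmt-QuantumFields-19936), route crux `BlockLipschitzL` (stmt-QuantumFields-23533), K2 supplier plan
# (card v1.27, w2-19936 g10's (R4)-LOCATE §3), FILE F4 — THE BOX-LOCAL TWINS OF THE ONE-STEP TRUE-LINEARISATION ROWS E4 (LINE), E5 (DEFECT), E10 (REMAINDER):
# the same `ℓ²`∕`ℓ¹` bounds with `Σ_{c ∈ C}` on the left and `Σ_{b ∈ S}` on the right for ANY finite set `C` of coarse bonds and ANY set `S` of fine bonds containing the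
# two-block neighbourhoods `N(c)`, `c ∈ C` — and with the background∕ratio windows asked ONLY on `C` and `S`

Cell `ym3-torus` (YM ladder rung R3 = continuum SU(2) Yang–Mills on the three-torus — a RUNG, NOT the Clay problem: not d = 4, not infinite volume, not a mass gap);
width seat `ym3-torus-px7` gen 4 on LEAD ym-ust-19936-w1 g7's pen «F4 → px7» (2026-08-29T00:35:51Z).  THEOREMS ONLY (def-free); any `Params`, any `SU(n)`, one level
`j + 1 ≤ m + K`; `--supports stmt-QuantumFields-23533`.  Nothing here proves `hStab`, F5, a stub, `BlockLipschitzL`, `HistoryTailL` or a summit statement.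

WHY.  `hStab⋆` (card v1.27) carries a BOX norm `‖X‖_{ℓ²(17L^{j+1}-box)}` and goodness windows on a neighbourhood of `a` only, while the one-step engines of the 19200 lane are
stated with GLOBAL torus sums and global windows: E4 ✓`Prop7TrueLinLineBound.sum_normSq_line_le` (`Σ_c‖LINE_VZ(c)‖² ≤ L^{2−d}Σ_b‖Z b‖²`), E5 ✓`Prop7TrueLinDefectBound.sum_normSq_defect_le`
(`Σ_c‖D(c)‖² ≤ (159α(d+2)L)²(2dL^d)(2d)Σ_b‖Z b‖²`), E10 ✓`Prop7FibreRemainderL1Level.sum_norm_ratio_sub_trueLin_le_mass` (`Σ_c‖R(c)‖ ≤ 260((d+2)L)²(2dL^d)(2d)Σ_b‖Y b‖²`).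
Every one of them is the sum over `c` of a POINTWISE row that reads the fine field only on `N(c) = {b : blockOf b₋ ∈ {c₋, c₊}}` (✓`norm_line_le`, ✓`norm_defect_le_nbhd`,
✓`norm_ratio_sub_trueLin_le_nbhdMass`), followed by a multiplicity count (✓`sum_coarse_offsets_shifts`: the line bonds are hit `L` times; ✓`sum_nbhd_le`: a fine bond lies in
`≤ 2d` neighbourhoods).  THIS FILE redoes the two counts over a sub-family `C` against a reading set `S ⊇ ⋃_{c∈C} N(c)` (indicator trick: the global count applied to `𝟙_S·g`),
so F5's per-level induction (w2 g10) runs with `ℓ²(box_i)` norms and box-local windows: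

* §1 `blockOf_shift_iterate_blockSite` — the line bonds `⟨shift^t(blockSite c₋ r), μ_c⟩`, `t < L`, issue from `B(c₋) ∪ B(c₊)` (exported; inside ✓`mass_segment_le` so far);
  `sum_nbhd_le_local` (`Σ_{c∈C}Σ_{b∈N(c)} g ≤ 2d·Σ_{b∈S} g`), `sum_line_bonds_le_local` (`Σ_{c∈C}Σ_rΣ_{t<L} g(line bond) ≤ L·Σ_{b∈S} g`), for `g ≥ 0`.
* §2 ★ `sum_normSq_line_le_local` (E4-loc) — `Σ_{c∈C}‖LINE_VZ(c)‖² ≤ (L^d)⁻¹L²·Σ_{b∈S}‖Z b‖²`.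
* §3 ★ `sum_normSq_defect_le_local` (E5-loc) — loop windows `dist1(loopHol V c i) ≤ α` asked for `c ∈ C` only: `Σ_{c∈C}‖D(c)‖² ≤ (159α(d+2)L)²(2dL^d)(2d)·Σ_{b∈S}‖Z b‖²`.
* §4 ★ `norm_ratio_sub_trueLin_le_nbhdMass_local` (E10 pointwise with the sup of `Y` asked on `N(c)` only) and ★★ `sum_norm_ratio_sub_trueLin_le_mass_local` (E10-loc) —
  `Σ_{c∈C}‖Ū(c)Ū₀(c)* − 1 − T(U₀)[Y](c)‖ ≤ 260((d+2)L)²(2dL^d)(2d)·Σ_{b∈S}‖Y b‖²`, windows on `C`, sup of `Y` on `S`.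
[folklore] bookkeeping over [Balaban1985Averaging] Prop. 3 (122)–(126) p.36 and [Balaban1987RG1] (0.3)–(0.4) pp.252–253; no new analysis.
-/

set_option autoImplicit false

noncomputable section

open scoped BigOperators Matrix.Norms.L2Operator

namespace Summit.QuantumFields.YangMills.Theorems.PoincareLipschitzTrueLinBoxLocalRows

open Literature.MathematicalPhysics.QuantumFieldTheory.Balaban1983to89
open Finset T4Continuum BlockAveraging AveragingRT ExpMeanLog BlockAveragingEMLLinearised BlockAveragingEMLLinearisedBackground BlockAveragingEMLProp2
open Summit.QuantumFields.YangMills.Theorems.Prop7TrueLinLineBound (norm_line_le sum_coarse_offsets_shifts)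
open Summit.QuantumFields.YangMills.Theorems.Prop7TrueLinDefectBound (mass_loop_le mass_segment_le card_nbhd_le sum_nbhd_le norm_defect_le_nbhd)
open Summit.QuantumFields.YangMills.Theorems.Prop7HolRatioPerStep (norm_avgFun_ratio_sub_one_sub_trueLin_le)
open Summit.QuantumFields.YangMills.Theorems.Prop7FibreRemainderL1Level (nbhdMass_sq_le)

variable {P : Params} {n : Type*} [Fintype n] [DecidableEq n] [Nonempty n] {j : ℕ}

/-! ## §1 Where the line bonds live, and the two multiplicity counts over a sub-family `C` against a reading set `S` -/

omit [Fintype n] [DecidableEq n] [Nonempty n] in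
/-- Iterated unit shifts are the straight shift `shiftN`. [folklore] -/
theorem shift_iterate_eq_shiftN (x : Site P j) (μ : Fin P.d) : ∀ t : ℕ, (fun z : Site P j => z.shift μ)^[t] x = B10Eq47AxialChi.shiftN x μ t
  | 0 => rfl
  | t + 1 => by
    rw [Function.iterate_succ_apply', shift_iterate_eq_shiftN x μ t, B10Eq47AxialChi.shiftN_succ]

omit [Fintype n] [DecidableEq n] [Nonempty n] in
/-- **THE LINE BONDS ISSUE FROM `B(c₋) ∪ B(c₊)`**: for `t < L`, `blockOf(shift^t(blockSite c₋ r)) ∈ {c₋, c₊}` (first part of the segment in `B(c₋)`, the rest in `B(c₊)`;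
standing range). [cite: Balaban1987RG1, (0.3)-(0.4) pp.252-253] -/
theorem blockOf_shift_iterate_blockSite (hj : j + 1 ≤ P.m + P.K) (c : PBond P (j + 1)) (r : Fin P.d → Fin P.L) (t : ℕ) (ht : t < P.L) :
    blockOf ((fun z : Site P j => z.shift c.dir)^[t] (Site.blockSite c.src r)) = c.src ∨
      blockOf ((fun z : Site P j => z.shift c.dir)^[t] (Site.blockSite c.src r)) = c.tgt := by
  have hL := two_mul_half_add_one P
  set h : ℕ := (P.L - 1) / 2 with hh
  rw [shift_iterate_eq_shiftN]
  -- coordinates relative to the centre `emb c₋`: `e ν = off r ν + t·[ν = dir]`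
  have hcoord : ∀ ν, B10Eq47AxialChi.shiftN (Site.blockSite c.src r) c.dir t ν =
      emb c.src ν + (((off r ν + (if ν = c.dir then (t : ℤ) else 0) : ℤ)) : ZMod (P.sitesPerDir j)) := by
    intro ν
    rw [shiftN_apply]
    simp only [Site.blockSite, emb, off]
    simp only [← hh]
    by_cases hν : ν = c.dir
    · rw [if_pos hν, if_pos hν]; push_cast; ring
    · rw [if_neg hν, if_neg hν]; push_cast; ring
  by_cases hfar : (r c.dir : ℕ) + t ≤ P.L - 1
  · left
    refine blockOf_eq_of_near_emb hj c.src _ (fun ν => off r ν + (if ν = c.dir then (t : ℤ) else 0)) hcoord (fun ν => ?_)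
    have hb := off_bounds r ν
    by_cases hν : ν = c.dir
    · subst hν
      rw [if_pos rfl]
      have hr := (r c.dir).isLt
      simp only [off] at hb ⊢
      constructor <;> omega
    · rw [if_neg hν, add_zero]; exact hb
  · right
    refine blockOf_eq_of_near_emb hj c.tgt _ (fun ν => off r ν + (if ν = c.dir then (t : ℤ) else 0) - (if ν = c.dir then (P.L : ℤ) else 0)) ?_ ?_
    · intro ν
      rw [hcoord, PBond.tgt, emb_shift_apply]
      by_cases hν : ν = c.dir
      · rw [if_pos hν, if_pos hν, if_pos hν]; push_cast; ring
      · rw [if_neg hν, if_neg hν, if_neg hν]; push_cast; ring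
    · intro ν
      have hb := off_bounds r ν
      by_cases hν : ν = c.dir
      · subst hν
        rw [if_pos rfl, if_pos rfl]
        have hr := (r c.dir).isLt
        simp only [off] at hb ⊢
        constructor <;> omega
      · rw [if_neg hν, if_neg hν, add_zero, sub_zero]; exact hb

omit [Fintype n] [DecidableEq n] [Nonempty n] in
/-- **MULTIPLICITY OVER A SUB-FAMILY**: if `S` contains the neighbourhoods `N(c)` of all `c ∈ C`, then `Σ_{c∈C} Σ_{b∈N(c)} g b ≤ 2d·Σ_{b∈S} g b` for `g ≥ 0`
(✓`sum_nbhd_le` applied to `𝟙_S·g`). [folklore] -/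
theorem sum_nbhd_le_local (C : Finset (PBond P (j + 1))) (S : Finset (PBond P j))
    (hS : ∀ c ∈ C, ∀ b : PBond P j, (blockOf b.src = c.src ∨ blockOf b.src = c.tgt) → b ∈ S) (g : PBond P j → ℝ) (hg : ∀ b, 0 ≤ g b) :
    ∑ c ∈ C, ∑ b ∈ univ.filter (fun b : PBond P j => blockOf b.src = c.src ∨ blockOf b.src = c.tgt), g b ≤ 2 * P.d * ∑ b ∈ S, g b := by
  classical
  set g' : PBond P j → ℝ := fun b => if b ∈ S then g b else 0 with hg'
  have hg'0 : ∀ b, 0 ≤ g' b := fun b => by simp only [hg']; split_ifs <;> simp [hg b]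
  have h1 : ∑ c ∈ C, ∑ b ∈ univ.filter (fun b : PBond P j => blockOf b.src = c.src ∨ blockOf b.src = c.tgt), g b =
      ∑ c ∈ C, ∑ b ∈ univ.filter (fun b : PBond P j => blockOf b.src = c.src ∨ blockOf b.src = c.tgt), g' b := by
    refine Finset.sum_congr rfl fun c hc => Finset.sum_congr rfl fun b hb => ?_
    simp only [hg', if_pos (hS c hc b (Finset.mem_filter.1 hb).2)]
  have h2 : ∑ c ∈ C, ∑ b ∈ univ.filter (fun b : PBond P j => blockOf b.src = c.src ∨ blockOf b.src = c.tgt), g' b ≤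
      ∑ c : PBond P (j + 1), ∑ b ∈ univ.filter (fun b : PBond P j => blockOf b.src = c.src ∨ blockOf b.src = c.tgt), g' b :=
    Finset.sum_le_sum_of_subset_of_nonneg (Finset.subset_univ C) fun c _ _ => Finset.sum_nonneg fun b _ => hg'0 b
  have h3 := sum_nbhd_le (P := P) g' hg'0
  have h4 : ∑ b : PBond P j, g' b = ∑ b ∈ S, g b := by
    rw [hg', ← Finset.sum_filter]; simp
  rw [h1]
  calc _ ≤ _ := h2
    _ ≤ 2 * P.d * ∑ b : PBond P j, g' b := h3
    _ = 2 * P.d * ∑ b ∈ S, g b := by rw [h4]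

omit [Fintype n] [DecidableEq n] [Nonempty n] in
/-- **THE LINE BONDS OVER A SUB-FAMILY ARE HIT AT MOST `L` TIMES INSIDE `S`**: `Σ_{c∈C} Σ_r Σ_{t<L} g⟨shift^t(blockSite c₋ r), μ_c⟩ ≤ L·Σ_{b∈S} g b` for `g ≥ 0`
(✓`sum_coarse_offsets_shifts` applied to `𝟙_S·g`; §1 puts every line bond in `N(c) ⊆ S`). [cite: Balaban1984PropagatorsI, (1.11) p.19] -/
theorem sum_line_bonds_le_local (hj : j + 1 ≤ P.m + P.K) (C : Finset (PBond P (j + 1))) (S : Finset (PBond P j))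
    (hS : ∀ c ∈ C, ∀ b : PBond P j, (blockOf b.src = c.src ∨ blockOf b.src = c.tgt) → b ∈ S) (g : PBond P j → ℝ) (hg : ∀ b, 0 ≤ g b) :
    ∑ c ∈ C, ∑ r : Fin P.d → Fin P.L, ∑ t ∈ Finset.range P.L, g ⟨(fun z : Site P j => z.shift c.dir)^[t] (Site.blockSite c.src r), c.dir⟩
      ≤ (P.L : ℝ) * ∑ b ∈ S, g b := by
  classical
  set g' : PBond P j → ℝ := fun b => if b ∈ S then g b else 0 with hg'
  have hg'0 : ∀ b, 0 ≤ g' b := fun b => by simp only [hg']; split_ifs <;> simp [hg b]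
  have h1 : ∑ c ∈ C, ∑ r : Fin P.d → Fin P.L, ∑ t ∈ Finset.range P.L, g ⟨(fun z : Site P j => z.shift c.dir)^[t] (Site.blockSite c.src r), c.dir⟩ =
      ∑ c ∈ C, ∑ r : Fin P.d → Fin P.L, ∑ t ∈ Finset.range P.L, g' ⟨(fun z : Site P j => z.shift c.dir)^[t] (Site.blockSite c.src r), c.dir⟩ := by
    refine Finset.sum_congr rfl fun c hc => Finset.sum_congr rfl fun r _ => Finset.sum_congr rfl fun t ht => ?_
    have hmem : (⟨(fun z : Site P j => z.shift c.dir)^[t] (Site.blockSite c.src r), c.dir⟩ : PBond P j) ∈ S :=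
      hS c hc ⟨(fun z : Site P j => z.shift c.dir)^[t] (Site.blockSite c.src r), c.dir⟩
        (blockOf_shift_iterate_blockSite hj c r t (Finset.mem_range.1 ht))
    simp only [hg', if_pos hmem]
  have h2 : ∑ c ∈ C, ∑ r : Fin P.d → Fin P.L, ∑ t ∈ Finset.range P.L, g' ⟨(fun z : Site P j => z.shift c.dir)^[t] (Site.blockSite c.src r), c.dir⟩ ≤
      ∑ c : PBond P (j + 1), ∑ r : Fin P.d → Fin P.L, ∑ t ∈ Finset.range P.L, g' ⟨(fun z : Site P j => z.shift c.dir)^[t] (Site.blockSite c.src r), c.dir⟩ :=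
    Finset.sum_le_sum_of_subset_of_nonneg (Finset.subset_univ C) fun c _ _ =>
      Finset.sum_nonneg fun r _ => Finset.sum_nonneg fun t _ => hg'0 _
  have h3 := sum_coarse_offsets_shifts hj g'
  have h4 : ∑ b : PBond P j, g' b = ∑ b ∈ S, g b := by
    rw [hg', ← Finset.sum_filter]; simp
  rw [h1]
  calc _ ≤ _ := h2
    _ = (P.L : ℝ) * ∑ b : PBond P j, g' b := h3
    _ = (P.L : ℝ) * ∑ b ∈ S, g b := by rw [h4]


/-! ## §2 ★ E4-loc: the `ℓ²` contraction of `LINE_V` over a sub-family -/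

/-- ★ **E4-loc — `Σ_{c∈C} ‖LINE_VZ(c)‖² ≤ (L^d)⁻¹·L²·Σ_{b∈S} ‖Z(b)‖²`** for every finite family `C` of coarse bonds and every reading set `S ⊇ ⋃_{c∈C} N(c)`
(pointwise ✓`norm_line_le`, Cauchy–Schwarz over the `L^{d+1}` line bonds, §1's local `L`-to-one count).  The global row ✓`sum_normSq_line_le` is `C = univ`, `S = univ`.
[cite: Balaban1984PropagatorsI, (1.11), (1.18) pp.19-20] -/
theorem sum_normSq_line_le_local (hj : j + 1 ≤ P.m + P.K) (V : GaugeField P j (Matrix.specialUnitaryGroup n ℂ)) (Z : PBond P j → Matrix n n ℂ)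
    (C : Finset (PBond P (j + 1))) (S : Finset (PBond P j))
    (hS : ∀ c ∈ C, ∀ b : PBond P j, (blockOf b.src = c.src ∨ blockOf b.src = c.tgt) → b ∈ S) :
    ∑ c ∈ C, ‖((Fintype.card (Idx P) : ℂ))⁻¹ • ∑ i : Idx P,
        ((holAt V (walk (emb c.src) (stairWord i.2.1 (off i.1))) : Matrix.specialUnitaryGroup n ℂ) : Matrix n n ℂ) *
          covWalkSum V Z (walk (walkEnd (emb c.src) (stairWord i.2.1 (off i.1))) (List.replicate P.L (c.dir, true))) *
        star ((holAt V (walk (emb c.src) (stairWord i.2.1 (off i.1))) : Matrix.specialUnitaryGroup n ℂ) : Matrix n n ℂ)‖ ^ 2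
      ≤ ((P.L : ℝ) ^ P.d)⁻¹ * (P.L : ℝ) ^ 2 * ∑ b ∈ S, ‖Z b‖ ^ 2 := by
  have hLpos : (0 : ℝ) < (P.L : ℝ) := by exact_mod_cast P.L_pos
  have hLd : (0 : ℝ) < (P.L : ℝ) ^ P.d := pow_pos hLpos _
  set A : PBond P (j + 1) → (Fin P.d → Fin P.L) → ℕ → ℝ :=
    fun c r t => ‖Z ⟨(fun z : Site P j => z.shift c.dir)^[t] (Site.blockSite c.src r), c.dir⟩‖ with hA
  -- Cauchy–Schwarz per coarse bond
  have hCS : ∀ c : PBond P (j + 1),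
      (∑ r : Fin P.d → Fin P.L, ∑ t ∈ Finset.range P.L, A c r t) ^ 2
        ≤ ((P.L : ℝ) ^ P.d * P.L) * ∑ r : Fin P.d → Fin P.L, ∑ t ∈ Finset.range P.L, A c r t ^ 2 := by
    intro c
    have h := sq_sum_le_card_mul_sum_sq (s := (Finset.univ : Finset (Fin P.d → Fin P.L)) ×ˢ Finset.range P.L) (f := fun p => A c p.1 p.2)
    rw [Finset.sum_product, Finset.sum_product, Finset.card_product, Finset.card_univ, Fintype.card_fun, Fintype.card_fin, Fintype.card_fin,
      Finset.card_range] at h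
    push_cast at h
    exact h
  have hpt : ∀ c : PBond P (j + 1), ‖((Fintype.card (Idx P) : ℂ))⁻¹ • ∑ i : Idx P,
        ((holAt V (walk (emb c.src) (stairWord i.2.1 (off i.1))) : Matrix.specialUnitaryGroup n ℂ) : Matrix n n ℂ) *
          covWalkSum V Z (walk (walkEnd (emb c.src) (stairWord i.2.1 (off i.1))) (List.replicate P.L (c.dir, true))) *
        star ((holAt V (walk (emb c.src) (stairWord i.2.1 (off i.1))) : Matrix.specialUnitaryGroup n ℂ) : Matrix n n ℂ)‖ ^ 2
      ≤ ((P.L : ℝ) ^ P.d)⁻¹ * P.L * ∑ r : Fin P.d → Fin P.L, ∑ t ∈ Finset.range P.L, A c r t ^ 2 := by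
    intro c
    have h1 := norm_line_le V Z c
    have h0 : 0 ≤ ∑ r : Fin P.d → Fin P.L, ∑ t ∈ Finset.range P.L, A c r t :=
      Finset.sum_nonneg fun r _ => Finset.sum_nonneg fun t _ => norm_nonneg _
    calc _ ≤ (((P.L : ℝ) ^ P.d)⁻¹ * ∑ r : Fin P.d → Fin P.L, ∑ t ∈ Finset.range P.L, A c r t) ^ 2 :=
          pow_le_pow_left₀ (norm_nonneg _) h1 2
      _ = (((P.L : ℝ) ^ P.d)⁻¹) ^ 2 * (∑ r : Fin P.d → Fin P.L, ∑ t ∈ Finset.range P.L, A c r t) ^ 2 := by ring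
      _ ≤ (((P.L : ℝ) ^ P.d)⁻¹) ^ 2 * (((P.L : ℝ) ^ P.d * P.L) * ∑ r : Fin P.d → Fin P.L, ∑ t ∈ Finset.range P.L, A c r t ^ 2) :=
          mul_le_mul_of_nonneg_left (hCS c) (by positivity)
      _ = ((P.L : ℝ) ^ P.d)⁻¹ * P.L * ∑ r : Fin P.d → Fin P.L, ∑ t ∈ Finset.range P.L, A c r t ^ 2 := by
          field_simp
  have hcount := sum_line_bonds_le_local hj C S hS (fun b : PBond P j => ‖Z b‖ ^ 2) (fun b => sq_nonneg _)
  calc _ ≤ ∑ c ∈ C, ((P.L : ℝ) ^ P.d)⁻¹ * P.L * ∑ r : Fin P.d → Fin P.L, ∑ t ∈ Finset.range P.L, A c r t ^ 2 :=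
        Finset.sum_le_sum fun c _ => hpt c
    _ = ((P.L : ℝ) ^ P.d)⁻¹ * P.L * ∑ c ∈ C, ∑ r : Fin P.d → Fin P.L, ∑ t ∈ Finset.range P.L, A c r t ^ 2 := by rw [← Finset.mul_sum]
    _ ≤ ((P.L : ℝ) ^ P.d)⁻¹ * P.L * ((P.L : ℝ) * ∑ b ∈ S, ‖Z b‖ ^ 2) := mul_le_mul_of_nonneg_left hcount (by positivity)
    _ = ((P.L : ℝ) ^ P.d)⁻¹ * (P.L : ℝ) ^ 2 * ∑ b ∈ S, ‖Z b‖ ^ 2 := by ring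

/-! ## §3 ★ E5-loc: the `ℓ²` defect row over a sub-family, windows on the sub-family only -/

/-- ★ **E5-loc — `Σ_{c∈C} ‖D(c)‖² ≤ (159·α·(d+2)L)²·(2dL^d)·(2d)·Σ_{b∈S} ‖Z(b)‖²`**, the (0.4) loop windows `dist1(loopHol V c i) ≤ α` (`α ≤ 1/24`, `α < δ_N`) asked ONLY
for `c ∈ C`, the reading set `S ⊇ ⋃_{c∈C} N(c)` (pointwise ✓`norm_defect_le_nbhd`, Cauchy–Schwarz on `|N(c)| ≤ 2dL^d`, §1's local multiplicity).  The global row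
✓`sum_normSq_defect_le` is `C = univ`, `S = univ`. [cite: Balaban1985Averaging, Prop. 3 (124)-(126) p.36] -/
theorem sum_normSq_defect_le_local (hj : j + 1 ≤ P.m + P.K) (V : GaugeField P j (Matrix.specialUnitaryGroup n ℂ)) (Z : PBond P j → Matrix n n ℂ)
    (C : Finset (PBond P (j + 1))) (S : Finset (PBond P j))
    (hS : ∀ c ∈ C, ∀ b : PBond P j, (blockOf b.src = c.src ∨ blockOf b.src = c.tgt) → b ∈ S)
    {α : ℝ} (hα : ∀ c ∈ C, ∀ i : Idx P, dist1 (loopHol V c i) ≤ α) (hα24 : α ≤ 1 / 24) (hN : α < deltaSU n) :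
    ∑ c ∈ C,
      ‖(fderiv ℂ (eml : (Idx P → Matrix n n ℂ) → Matrix n n ℂ) (fun i => ((loopHol V c i : Matrix.specialUnitaryGroup n ℂ) : Matrix n n ℂ))
          (fun i => covWalkSum V Z (walk (emb c.src) (loopWord P.L c.dir (off i.1) i.2.1 i.2.2))
            * ((loopHol V c i : Matrix.specialUnitaryGroup n ℂ) : Matrix n n ℂ))
          * star ((corr (expMeanLogSU (n := n)) V c : Matrix.specialUnitaryGroup n ℂ) : Matrix n n ℂ)
        + ((corr (expMeanLogSU (n := n)) V c : Matrix.specialUnitaryGroup n ℂ) : Matrix n n ℂ)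
          * covWalkSum V Z (walk (emb c.src) (List.replicate P.L (c.dir, true)))
          * star ((corr (expMeanLogSU (n := n)) V c : Matrix.specialUnitaryGroup n ℂ) : Matrix n n ℂ))
      - ((((Fintype.card (Idx P) : ℂ))⁻¹ • ∑ i : Idx P, covWalkSum V Z (walk (emb c.src) (stairWord i.2.1 (off i.1))))
          - ((avgFun (expMeanLogSU (n := n)) V c : Matrix.specialUnitaryGroup n ℂ) : Matrix n n ℂ)
              * (((Fintype.card (Idx P) : ℂ))⁻¹ • ∑ i : Idx P, covWalkSum V Z (walk (emb c.tgt) (stairWord i.2.1 (off i.1))))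
              * star ((avgFun (expMeanLogSU (n := n)) V c : Matrix.specialUnitaryGroup n ℂ) : Matrix n n ℂ))
      - ((Fintype.card (Idx P) : ℂ))⁻¹ • ∑ i : Idx P,
          ((holAt V (walk (emb c.src) (stairWord i.2.1 (off i.1))) : Matrix.specialUnitaryGroup n ℂ) : Matrix n n ℂ) *
            covWalkSum V Z (walk (walkEnd (emb c.src) (stairWord i.2.1 (off i.1))) (List.replicate P.L (c.dir, true))) *
          star ((holAt V (walk (emb c.src) (stairWord i.2.1 (off i.1))) : Matrix.specialUnitaryGroup n ℂ) : Matrix n n ℂ)‖ ^ 2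
      ≤ (159 * α * (((P.d + 2) * P.L : ℕ) : ℝ)) ^ 2 * (2 * P.d * (P.L : ℝ) ^ P.d) * (2 * P.d) * ∑ b ∈ S, ‖Z b‖ ^ 2 := by
  set K : ℝ := 159 * α * (((P.d + 2) * P.L : ℕ) : ℝ) with hK
  have hpt : ∀ c ∈ C,
      ‖(fderiv ℂ (eml : (Idx P → Matrix n n ℂ) → Matrix n n ℂ) (fun i => ((loopHol V c i : Matrix.specialUnitaryGroup n ℂ) : Matrix n n ℂ))
          (fun i => covWalkSum V Z (walk (emb c.src) (loopWord P.L c.dir (off i.1) i.2.1 i.2.2))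
            * ((loopHol V c i : Matrix.specialUnitaryGroup n ℂ) : Matrix n n ℂ))
          * star ((corr (expMeanLogSU (n := n)) V c : Matrix.specialUnitaryGroup n ℂ) : Matrix n n ℂ)
        + ((corr (expMeanLogSU (n := n)) V c : Matrix.specialUnitaryGroup n ℂ) : Matrix n n ℂ)
          * covWalkSum V Z (walk (emb c.src) (List.replicate P.L (c.dir, true)))
          * star ((corr (expMeanLogSU (n := n)) V c : Matrix.specialUnitaryGroup n ℂ) : Matrix n n ℂ))
      - ((((Fintype.card (Idx P) : ℂ))⁻¹ • ∑ i : Idx P, covWalkSum V Z (walk (emb c.src) (stairWord i.2.1 (off i.1))))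
          - ((avgFun (expMeanLogSU (n := n)) V c : Matrix.specialUnitaryGroup n ℂ) : Matrix n n ℂ)
              * (((Fintype.card (Idx P) : ℂ))⁻¹ • ∑ i : Idx P, covWalkSum V Z (walk (emb c.tgt) (stairWord i.2.1 (off i.1))))
              * star ((avgFun (expMeanLogSU (n := n)) V c : Matrix.specialUnitaryGroup n ℂ) : Matrix n n ℂ))
      - ((Fintype.card (Idx P) : ℂ))⁻¹ • ∑ i : Idx P,
          ((holAt V (walk (emb c.src) (stairWord i.2.1 (off i.1))) : Matrix.specialUnitaryGroup n ℂ) : Matrix n n ℂ) *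
            covWalkSum V Z (walk (walkEnd (emb c.src) (stairWord i.2.1 (off i.1))) (List.replicate P.L (c.dir, true))) *
          star ((holAt V (walk (emb c.src) (stairWord i.2.1 (off i.1))) : Matrix.specialUnitaryGroup n ℂ) : Matrix n n ℂ)‖ ^ 2
        ≤ K ^ 2 * (2 * P.d * (P.L : ℝ) ^ P.d) * ∑ b ∈ univ.filter (fun b : PBond P j => blockOf b.src = c.src ∨ blockOf b.src = c.tgt), ‖Z b‖ ^ 2 := by
    intro c hc
    have h1 := norm_defect_le_nbhd hj V Z c (hα c hc) hα24 hN
    have hCS := sq_sum_le_card_mul_sum_sq (s := univ.filter (fun b : PBond P j => blockOf b.src = c.src ∨ blockOf b.src = c.tgt)) (f := fun b => ‖Z b‖)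
    have hcard := card_nbhd_le (P := P) hj c
    have hsq0 : 0 ≤ ∑ b ∈ univ.filter (fun b : PBond P j => blockOf b.src = c.src ∨ blockOf b.src = c.tgt), ‖Z b‖ ^ 2 := Finset.sum_nonneg fun b _ => sq_nonneg _
    calc _ ≤ (K * ∑ b ∈ univ.filter (fun b : PBond P j => blockOf b.src = c.src ∨ blockOf b.src = c.tgt), ‖Z b‖) ^ 2 := by
          exact pow_le_pow_left₀ (norm_nonneg _) (h1.trans_eq (by rw [hK]; ring)) 2
      _ = K ^ 2 * (∑ b ∈ univ.filter (fun b : PBond P j => blockOf b.src = c.src ∨ blockOf b.src = c.tgt), ‖Z b‖) ^ 2 := by ring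
      _ ≤ K ^ 2 * (((univ.filter (fun b : PBond P j => blockOf b.src = c.src ∨ blockOf b.src = c.tgt)).card : ℝ) * ∑ b ∈ univ.filter (fun b : PBond P j => blockOf b.src = c.src ∨ blockOf b.src = c.tgt), ‖Z b‖ ^ 2) := mul_le_mul_of_nonneg_left hCS (sq_nonneg _)
      _ ≤ K ^ 2 * ((2 * P.d * (P.L : ℝ) ^ P.d) * ∑ b ∈ univ.filter (fun b : PBond P j => blockOf b.src = c.src ∨ blockOf b.src = c.tgt), ‖Z b‖ ^ 2) :=
          mul_le_mul_of_nonneg_left (mul_le_mul_of_nonneg_right hcard hsq0) (sq_nonneg _)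
      _ = _ := by ring
  have hcount := sum_nbhd_le_local C S hS (fun b : PBond P j => ‖Z b‖ ^ 2) (fun b => sq_nonneg _)
  calc _ ≤ ∑ c ∈ C, K ^ 2 * (2 * P.d * (P.L : ℝ) ^ P.d) * ∑ b ∈ univ.filter (fun b : PBond P j => blockOf b.src = c.src ∨ blockOf b.src = c.tgt), ‖Z b‖ ^ 2 := Finset.sum_le_sum fun c hc => hpt c hc
    _ = K ^ 2 * (2 * P.d * (P.L : ℝ) ^ P.d) * ∑ c ∈ C, ∑ b ∈ univ.filter (fun b : PBond P j => blockOf b.src = c.src ∨ blockOf b.src = c.tgt), ‖Z b‖ ^ 2 := by rw [Finset.mul_sum]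
    _ ≤ K ^ 2 * (2 * P.d * (P.L : ℝ) ^ P.d) * (2 * P.d * ∑ b ∈ S, ‖Z b‖ ^ 2) := mul_le_mul_of_nonneg_left hcount (by positivity)
    _ = K ^ 2 * (2 * P.d * (P.L : ℝ) ^ P.d) * (2 * P.d) * ∑ b ∈ S, ‖Z b‖ ^ 2 := by ring

/-! ## §4 ★ E10-loc: the per-level `ℓ¹` two-point remainder over a sub-family, in box `ℓ²`-mass currency -/

/-- ★ **E10 PER BOND, LOCAL WINDOWS**: as ✓`norm_ratio_sub_trueLin_le_nbhdMass`, but the sup `‖Y(b)‖ ≤ s` is asked ONLY on `N(c)`: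
`‖Ū(c)Ū₀(c)* − 1 − T(U₀)[Y](c)‖ ≤ 260·((d+2)L·S(c))²`, `S(c) = Σ_{b∈N(c)}‖Y(b)‖`. [cite: Balaban1985Averaging, Prop. 3 (122)-(126) p.36] -/
theorem norm_ratio_sub_trueLin_le_nbhdMass_local (hj : j + 1 ≤ P.m + P.K) (U₀ U : GaugeField P j (Matrix.specialUnitaryGroup n ℂ)) (c : PBond P (j + 1))
    {α s : ℝ} (hα : ∀ i : Idx P, dist1 (loopHol U₀ c i) ≤ α) (hα24 : α ≤ 1 / 24)
    (hs0 : 0 ≤ s) (hs : ∀ b : PBond P j, (blockOf b.src = c.src ∨ blockOf b.src = c.tgt) → ‖pertVar U₀ U b‖ ≤ s)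
    (h72 : 72 * ((((P.d + 2) * P.L : ℕ) : ℝ) * ((2 * P.d * (P.L : ℝ) ^ P.d) * s)) ≤ 1)
    (hN : 3 * ((((P.d + 2) * P.L : ℕ) : ℝ) * ((2 * P.d * (P.L : ℝ) ^ P.d) * s)) + α < deltaSU n) :
    ‖((avgFun (expMeanLogSU (n := n)) U c : Matrix.specialUnitaryGroup n ℂ) : Matrix n n ℂ) *
          star ((avgFun (expMeanLogSU (n := n)) U₀ c : Matrix.specialUnitaryGroup n ℂ) : Matrix n n ℂ) - 1 -
        (fderiv ℂ (eml : (Idx P → Matrix n n ℂ) → Matrix n n ℂ) (fun i => ((loopHol U₀ c i : Matrix.specialUnitaryGroup n ℂ) : Matrix n n ℂ))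
            (fun i => covWalkSum U₀ (pertVar U₀ U) (walk (emb c.src) (loopWord P.L c.dir (off i.1) i.2.1 i.2.2))
              * ((loopHol U₀ c i : Matrix.specialUnitaryGroup n ℂ) : Matrix n n ℂ))
            * star ((corr (expMeanLogSU (n := n)) U₀ c : Matrix.specialUnitaryGroup n ℂ) : Matrix n n ℂ)
          + ((corr (expMeanLogSU (n := n)) U₀ c : Matrix.specialUnitaryGroup n ℂ) : Matrix n n ℂ)
            * covWalkSum U₀ (pertVar U₀ U) (walk (emb c.src) (List.replicate P.L (c.dir, true)))
            * star ((corr (expMeanLogSU (n := n)) U₀ c : Matrix.specialUnitaryGroup n ℂ) : Matrix n n ℂ))‖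
      ≤ 260 * (((((P.d + 2) * P.L : ℕ) : ℝ)) * ∑ b ∈ (univ.filter (fun b : PBond P j => blockOf b.src = c.src ∨ blockOf b.src = c.tgt)), ‖pertVar U₀ U b‖) ^ 2 := by
  have hS0 : 0 ≤ ∑ b ∈ (univ.filter (fun b : PBond P j => blockOf b.src = c.src ∨ blockOf b.src = c.tgt)), ‖pertVar U₀ U b‖ := Finset.sum_nonneg fun _ _ => norm_nonneg _
  have hSle : ∑ b ∈ (univ.filter (fun b : PBond P j => blockOf b.src = c.src ∨ blockOf b.src = c.tgt)), ‖pertVar U₀ U b‖ ≤ (2 * P.d * (P.L : ℝ) ^ P.d) * s := by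
    calc ∑ b ∈ (univ.filter (fun b : PBond P j => blockOf b.src = c.src ∨ blockOf b.src = c.tgt)), ‖pertVar U₀ U b‖
        ≤ ∑ b ∈ (univ.filter (fun b : PBond P j => blockOf b.src = c.src ∨ blockOf b.src = c.tgt)), s := Finset.sum_le_sum fun b hb => hs b (Finset.mem_filter.1 hb).2
      _ = (((univ.filter (fun b : PBond P j => blockOf b.src = c.src ∨ blockOf b.src = c.tgt)).card : ℕ) : ℝ) * s := by rw [Finset.sum_const, nsmul_eq_mul]
      _ ≤ (2 * P.d * (P.L : ℝ) ^ P.d) * s := mul_le_mul_of_nonneg_right (card_nbhd_le (P := P) hj c) hs0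
  have hcast0 : (0 : ℝ) ≤ (((P.d + 2) * P.L : ℕ) : ℝ) := Nat.cast_nonneg _
  have hm_le : (((P.d + 2) * P.L : ℕ) : ℝ) * ∑ b ∈ (univ.filter (fun b : PBond P j => blockOf b.src = c.src ∨ blockOf b.src = c.tgt)), ‖pertVar U₀ U b‖ ≤ (((P.d + 2) * P.L : ℕ) : ℝ) * ((2 * P.d * (P.L : ℝ) ^ P.d) * s) :=
    mul_le_mul_of_nonneg_left hSle hcast0
  exact norm_avgFun_ratio_sub_one_sub_trueLin_le U₀ U c (fun i => mass_loop_le hj (pertVar U₀ U) c i) (mass_segment_le hj (pertVar U₀ U) c)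
    (by linarith) hα hα24 (by linarith)

/-- ★★ **E10-loc — `Σ_{c∈C} ‖Ū(c)Ū₀(c)* − 1 − T(U₀)[Y](c)‖ ≤ 260·((d+2)L)²·(2dL^d)·(2d)·Σ_{b∈S} ‖Y(b)‖²`**, the (0.4) loop windows of `U₀` asked for `c ∈ C`, the sup
`‖Y(b)‖ ≤ s` asked for `b ∈ S` (`S ⊇ ⋃_{c∈C} N(c)`), with E10's guards `72·((d+2)L·(2dL^d·s)) ≤ 1`, `3·(…) + α < δ_N`.  The global row
✓`sum_norm_ratio_sub_trueLin_le_mass` is `C = univ`, `S = univ`. [cite: Balaban1985Averaging, Prop. 3 (122)-(126) p.36; Balaban1987RG1, (0.4) p.253] -/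
theorem sum_norm_ratio_sub_trueLin_le_mass_local (hj : j + 1 ≤ P.m + P.K) (U₀ U : GaugeField P j (Matrix.specialUnitaryGroup n ℂ))
    (C : Finset (PBond P (j + 1))) (S : Finset (PBond P j))
    (hS : ∀ c ∈ C, ∀ b : PBond P j, (blockOf b.src = c.src ∨ blockOf b.src = c.tgt) → b ∈ S)
    {α s : ℝ} (hα : ∀ c ∈ C, ∀ i : Idx P, dist1 (loopHol U₀ c i) ≤ α) (hα24 : α ≤ 1 / 24)
    (hs0 : 0 ≤ s) (hs : ∀ b ∈ S, ‖pertVar U₀ U b‖ ≤ s)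
    (h72 : 72 * ((((P.d + 2) * P.L : ℕ) : ℝ) * ((2 * P.d * (P.L : ℝ) ^ P.d) * s)) ≤ 1)
    (hN : 3 * ((((P.d + 2) * P.L : ℕ) : ℝ) * ((2 * P.d * (P.L : ℝ) ^ P.d) * s)) + α < deltaSU n) :
    ∑ c ∈ C, ‖((avgFun (expMeanLogSU (n := n)) U c : Matrix.specialUnitaryGroup n ℂ) : Matrix n n ℂ) *
          star ((avgFun (expMeanLogSU (n := n)) U₀ c : Matrix.specialUnitaryGroup n ℂ) : Matrix n n ℂ) - 1 -
        (fderiv ℂ (eml : (Idx P → Matrix n n ℂ) → Matrix n n ℂ) (fun i => ((loopHol U₀ c i : Matrix.specialUnitaryGroup n ℂ) : Matrix n n ℂ))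
            (fun i => covWalkSum U₀ (pertVar U₀ U) (walk (emb c.src) (loopWord P.L c.dir (off i.1) i.2.1 i.2.2))
              * ((loopHol U₀ c i : Matrix.specialUnitaryGroup n ℂ) : Matrix n n ℂ))
            * star ((corr (expMeanLogSU (n := n)) U₀ c : Matrix.specialUnitaryGroup n ℂ) : Matrix n n ℂ)
          + ((corr (expMeanLogSU (n := n)) U₀ c : Matrix.specialUnitaryGroup n ℂ) : Matrix n n ℂ)
            * covWalkSum U₀ (pertVar U₀ U) (walk (emb c.src) (List.replicate P.L (c.dir, true)))
            * star ((corr (expMeanLogSU (n := n)) U₀ c : Matrix.specialUnitaryGroup n ℂ) : Matrix n n ℂ))‖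
      ≤ 260 * ((((P.d + 2) * P.L : ℕ) : ℝ)) ^ 2 * (2 * P.d * (P.L : ℝ) ^ P.d) * (2 * P.d) * ∑ b ∈ S, ‖pertVar U₀ U b‖ ^ 2 := by
  have hK0 : (0 : ℝ) ≤ 260 * ((((P.d + 2) * P.L : ℕ) : ℝ)) ^ 2 * (2 * P.d * (P.L : ℝ) ^ P.d) := by positivity
  have hpt : ∀ c ∈ C, ‖((avgFun (expMeanLogSU (n := n)) U c : Matrix.specialUnitaryGroup n ℂ) : Matrix n n ℂ) *
          star ((avgFun (expMeanLogSU (n := n)) U₀ c : Matrix.specialUnitaryGroup n ℂ) : Matrix n n ℂ) - 1 -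
        (fderiv ℂ (eml : (Idx P → Matrix n n ℂ) → Matrix n n ℂ) (fun i => ((loopHol U₀ c i : Matrix.specialUnitaryGroup n ℂ) : Matrix n n ℂ))
            (fun i => covWalkSum U₀ (pertVar U₀ U) (walk (emb c.src) (loopWord P.L c.dir (off i.1) i.2.1 i.2.2))
              * ((loopHol U₀ c i : Matrix.specialUnitaryGroup n ℂ) : Matrix n n ℂ))
            * star ((corr (expMeanLogSU (n := n)) U₀ c : Matrix.specialUnitaryGroup n ℂ) : Matrix n n ℂ)
          + ((corr (expMeanLogSU (n := n)) U₀ c : Matrix.specialUnitaryGroup n ℂ) : Matrix n n ℂ)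
            * covWalkSum U₀ (pertVar U₀ U) (walk (emb c.src) (List.replicate P.L (c.dir, true)))
            * star ((corr (expMeanLogSU (n := n)) U₀ c : Matrix.specialUnitaryGroup n ℂ) : Matrix n n ℂ))‖
      ≤ 260 * ((((P.d + 2) * P.L : ℕ) : ℝ)) ^ 2 * (2 * P.d * (P.L : ℝ) ^ P.d) * ∑ b ∈ (univ.filter (fun b : PBond P j => blockOf b.src = c.src ∨ blockOf b.src = c.tgt)), ‖pertVar U₀ U b‖ ^ 2 := by
    intro c hc
    refine (norm_ratio_sub_trueLin_le_nbhdMass_local hj U₀ U c (hα c hc) hα24 hs0 (fun b hb => hs b (hS c hc b hb)) h72 hN).trans ?_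
    have h1 := nbhdMass_sq_le hj (pertVar U₀ U) c
    have h2 : (0 : ℝ) ≤ 260 * ((((P.d + 2) * P.L : ℕ) : ℝ)) ^ 2 := by positivity
    calc 260 * (((((P.d + 2) * P.L : ℕ) : ℝ)) * ∑ b ∈ (univ.filter (fun b : PBond P j => blockOf b.src = c.src ∨ blockOf b.src = c.tgt)), ‖pertVar U₀ U b‖) ^ 2
        = 260 * ((((P.d + 2) * P.L : ℕ) : ℝ)) ^ 2 * (∑ b ∈ (univ.filter (fun b : PBond P j => blockOf b.src = c.src ∨ blockOf b.src = c.tgt)), ‖pertVar U₀ U b‖) ^ 2 := by ring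
      _ ≤ 260 * ((((P.d + 2) * P.L : ℕ) : ℝ)) ^ 2 * ((2 * P.d * (P.L : ℝ) ^ P.d) * ∑ b ∈ (univ.filter (fun b : PBond P j => blockOf b.src = c.src ∨ blockOf b.src = c.tgt)), ‖pertVar U₀ U b‖ ^ 2) :=
          mul_le_mul_of_nonneg_left h1 h2
      _ = _ := by ring
  have hcount := sum_nbhd_le_local C S hS (fun b : PBond P j => ‖pertVar U₀ U b‖ ^ 2) (fun b => sq_nonneg _)
  calc _ ≤ ∑ c ∈ C, 260 * ((((P.d + 2) * P.L : ℕ) : ℝ)) ^ 2 * (2 * P.d * (P.L : ℝ) ^ P.d) * ∑ b ∈ (univ.filter (fun b : PBond P j => blockOf b.src = c.src ∨ blockOf b.src = c.tgt)), ‖pertVar U₀ U b‖ ^ 2 :=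
        Finset.sum_le_sum fun c hc => hpt c hc
    _ = 260 * ((((P.d + 2) * P.L : ℕ) : ℝ)) ^ 2 * (2 * P.d * (P.L : ℝ) ^ P.d) * ∑ c ∈ C, ∑ b ∈ (univ.filter (fun b : PBond P j => blockOf b.src = c.src ∨ blockOf b.src = c.tgt)), ‖pertVar U₀ U b‖ ^ 2 := by
        rw [Finset.mul_sum]
    _ ≤ 260 * ((((P.d + 2) * P.L : ℕ) : ℝ)) ^ 2 * (2 * P.d * (P.L : ℝ) ^ P.d) * (2 * P.d * ∑ b ∈ S, ‖pertVar U₀ U b‖ ^ 2) :=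
        mul_le_mul_of_nonneg_left hcount hK0
    _ = _ := by ring

end Summit.QuantumFields.YangMills.Theorems.PoincareLipschitzTrueLinBoxLocalRows

end
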